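import Summits.AtomisticToContinuum.FouriersLaw.Theses.LocalOhmBV

/-!
# Route LocalOhmBV — the finite-sum glue `LocalOhmGlue`

`LocalOhmGlue : FiniteResponseProfile → LocalOhm → BVProfile → BoundedResponse`
(item stmt-AtomisticToContinuum-12072 of route `route-AtomisticToContinuum-LocalOhmBV`).

Proof (the planner's arithmetic, [folklore]; cf. Bonetto–Lebowitz–Rey-Bellet 2000 §6.3 for the
setting): fix parameters, uniqueness, a steady-state family `μ`, `T > 0` and response coefficients
`D` with the clause-(ii) limits. Choose the response profiles `θ_N : Fin N → ℝ` from
`FiniteResponseProfile`; get `C, ℓ, b` from `LocalOhm` and `C_BV` from `BVProfile`. For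
`N ≥ 4b + 2` sum the local Ohm inequality over the `N − 2b − 1` bulk bonds `x = b, …, N − b − 2`:
`(N−2b−1)|D_N|/(N−1) ≤ max(C,0) Σ_x W_x ≤ max(C,0)(2ℓ+1) Σ_i |θ_N(i+1) − θ_N(i)| ≤ K` with
`K = max(C,0)(2ℓ+1) max(C_BV,0)` (each bond lies in at most `2ℓ+1` windows), hence
`|D_N| ≤ 2K` because `(N−1) ≤ 2(N−2b−1)`. The finitely many `N < 4b+2` are dominated by
`Σ_{M<4b+2} |D_M|`.

Contents: two window-counting lemmas, the arithmetic core `localOhmGlue_bulk_bound`, and the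
closing theorem `localOhmGlue_proof` whose type is literally the route decl.
-/

namespace Summit.AtomisticToContinuum.FouriersLaw.Theorems

open Finset

/-- Window counting: the number of window centres `x < N` with `x ≤ i + ℓ` and `i ≤ x + ℓ`
(i.e. `|i − x| ≤ ℓ`) is at most `2ℓ + 1`. -/
theorem localOhmGlue_window_card_le (N i ℓ : ℕ) :
    ((Finset.range N).filter (fun x => x ≤ i + ℓ ∧ i ≤ x + ℓ)).card ≤ 2 * ℓ + 1 := by
  calc ((Finset.range N).filter (fun x => x ≤ i + ℓ ∧ i ≤ x + ℓ)).card
      ≤ (Finset.Icc (i - ℓ) (i + ℓ)).card := by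
        apply Finset.card_le_card
        intro x hx
        simp only [Finset.mem_filter, Finset.mem_range] at hx
        simp only [Finset.mem_Icc]
        omega
    _ = i + ℓ + 1 - (i - ℓ) := Nat.card_Icc _ _
    _ ≤ 2 * ℓ + 1 := by omega

/-- Summing the windowed bond variation of a profile `θ : Fin N → ℝ` over all window centres
`x < N` counts each bond `(i, i+1)` at most `2ℓ + 1` times, so the total is at most `2ℓ + 1`
times the total variation `Σ_i |θ(i+1) − θ(i)|`. -/
theorem localOhmGlue_window_sum_le (N ℓ : ℕ) (θ : Fin N → ℝ) :
    ∑ x ∈ Finset.range N, ∑ i : Fin N, ∑ j : Fin N,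
        (if j.val = i.val + 1 ∧ x ≤ i.val + ℓ ∧ i.val ≤ x + ℓ then |θ j - θ i| else 0)
      ≤ (2 * ℓ + 1 : ℝ) *
        ∑ i : Fin N, ∑ j : Fin N, (if j.val = i.val + 1 then |θ j - θ i| else 0) := by
  rw [Finset.sum_comm, Finset.mul_sum]
  refine Finset.sum_le_sum fun i _ => ?_
  rw [Finset.sum_comm, Finset.mul_sum]
  refine Finset.sum_le_sum fun j _ => ?_
  by_cases hj : j.val = i.val + 1
  · have h0 : 0 ≤ |θ j - θ i| := abs_nonneg _
    have hc := localOhmGlue_window_card_le N i.val ℓ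
    have hc' : (((Finset.range N).filter (fun x => x ≤ i.val + ℓ ∧ i.val ≤ x + ℓ)).card : ℝ)
        ≤ 2 * ℓ + 1 := by exact_mod_cast hc
    calc ∑ x ∈ Finset.range N,
          (if j.val = i.val + 1 ∧ x ≤ i.val + ℓ ∧ i.val ≤ x + ℓ then |θ j - θ i| else 0)
        = ∑ x ∈ Finset.range N, (if x ≤ i.val + ℓ ∧ i.val ≤ x + ℓ then |θ j - θ i| else 0) := by
          refine Finset.sum_congr rfl fun x _ => ?_
          simp only [hj, true_and]
      _ = (((Finset.range N).filter (fun x => x ≤ i.val + ℓ ∧ i.val ≤ x + ℓ)).card : ℝ)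
            * |θ j - θ i| := by
          rw [← Finset.sum_filter, Finset.sum_const, nsmul_eq_mul]
      _ ≤ (2 * ℓ + 1 : ℝ) * |θ j - θ i| := mul_le_mul_of_nonneg_right hc' h0
      _ = (2 * ℓ + 1 : ℝ) * (if j.val = i.val + 1 then |θ j - θ i| else 0) := by
          simp only [hj, if_true]
  · simp only [hj, false_and, if_false, Finset.sum_const_zero, mul_zero, le_refl]

/-- Arithmetic core of the glue: if `a ≥ 0` satisfies the local Ohm inequality
`a/(N−1) ≤ C · W_x(θ)` at every bulk bond `x` (`b ≤ x ≤ N − b − 2`) and the total variation of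
`θ` is at most `C_BV`, then for `N ≥ 4b + 2` we get `a ≤ 2 · max(C,0) · (2ℓ+1) · max(C_BV,0)`. -/
theorem localOhmGlue_bulk_bound {N ℓ b : ℕ} {a C CB : ℝ} (θ : Fin N → ℝ) (ha : 0 ≤ a)
    (hN : 4 * b + 2 ≤ N)
    (hloc : ∀ x : ℕ, b ≤ x → x + b + 2 ≤ N → a / ((N : ℝ) - 1) ≤
      C * ∑ i : Fin N, ∑ j : Fin N,
        (if j.val = i.val + 1 ∧ x ≤ i.val + ℓ ∧ i.val ≤ x + ℓ then |θ j - θ i| else 0))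
    (hS : ∑ i : Fin N, ∑ j : Fin N, (if j.val = i.val + 1 then |θ j - θ i| else 0) ≤ CB) :
    a ≤ 2 * (max C 0 * (2 * ℓ + 1) * max CB 0) := by
  -- notation
  set W : ℕ → ℝ := fun x => ∑ i : Fin N, ∑ j : Fin N,
      (if j.val = i.val + 1 ∧ x ≤ i.val + ℓ ∧ i.val ≤ x + ℓ then |θ j - θ i| else 0) with hW
  set S : ℝ := ∑ i : Fin N, ∑ j : Fin N, (if j.val = i.val + 1 then |θ j - θ i| else 0) with hS'
  have hWnn : ∀ x, 0 ≤ W x := by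
    intro x
    refine Finset.sum_nonneg fun i _ => Finset.sum_nonneg fun j _ => ?_
    split_ifs
    · exact abs_nonneg _
    · exact le_refl _
  have hSnn : 0 ≤ S := by
    refine Finset.sum_nonneg fun i _ => Finset.sum_nonneg fun j _ => ?_
    split_ifs
    · exact abs_nonneg _
    · exact le_refl _
  have hN2 : (2 : ℝ) ≤ N := by exact_mod_cast (show 2 ≤ N by omega)
  have hN1 : (0 : ℝ) < (N : ℝ) - 1 := by linarith
  have hNr : (4 * b + 2 : ℝ) ≤ N := by exact_mod_cast hN
  have hq : 0 ≤ a / ((N : ℝ) - 1) := div_nonneg ha hN1.le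
  have hC0 : 0 ≤ max C 0 := le_max_right _ _
  -- sum the local Ohm inequality over the bulk bonds
  have hsum : ∑ x ∈ Finset.Icc b (N - b - 2), a / ((N : ℝ) - 1)
      ≤ ∑ x ∈ Finset.Icc b (N - b - 2), max C 0 * W x := by
    refine Finset.sum_le_sum fun x hx => ?_
    rw [Finset.mem_Icc] at hx
    calc a / ((N : ℝ) - 1) ≤ C * W x := hloc x hx.1 (by omega)
      _ ≤ max C 0 * W x := mul_le_mul_of_nonneg_right (le_max_left _ _) (hWnn x)
  rw [Finset.sum_const, Nat.card_Icc, nsmul_eq_mul, ← Finset.mul_sum] at hsum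
  have hcard : ((N - b - 2 + 1 - b : ℕ) : ℝ) = (N : ℝ) - 2 * b - 1 := by
    have h : (N - b - 2 + 1 - b : ℕ) + (2 * b + 1) = N := by omega
    have h' : ((N - b - 2 + 1 - b : ℕ) : ℝ) + (2 * b + 1 : ℕ) = (N : ℕ) := by exact_mod_cast h
    push_cast at h'
    linarith
  rw [hcard] at hsum
  -- the bulk sum of windows is at most the sum over all centres, counted ≤ 2ℓ+1 times each
  have hsub : ∑ x ∈ Finset.Icc b (N - b - 2), W x ≤ ∑ x ∈ Finset.range N, W x := by
    refine Finset.sum_le_sum_of_subset_of_nonneg ?_ fun x _ _ => hWnn x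
    intro x hx
    rw [Finset.mem_Icc] at hx
    exact Finset.mem_range.mpr (by omega)
  have hwin : ∑ x ∈ Finset.range N, W x ≤ (2 * ℓ + 1 : ℝ) * S :=
    localOhmGlue_window_sum_le N ℓ θ
  have hkey : ((N : ℝ) - 2 * b - 1) * (a / ((N : ℝ) - 1))
      ≤ max C 0 * (2 * ℓ + 1) * max CB 0 := by
    calc ((N : ℝ) - 2 * b - 1) * (a / ((N : ℝ) - 1))
        ≤ max C 0 * ∑ x ∈ Finset.Icc b (N - b - 2), W x := hsum
      _ ≤ max C 0 * ∑ x ∈ Finset.range N, W x := mul_le_mul_of_nonneg_left hsub hC0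
      _ ≤ max C 0 * ((2 * ℓ + 1 : ℝ) * S) := mul_le_mul_of_nonneg_left hwin hC0
      _ ≤ max C 0 * ((2 * ℓ + 1 : ℝ) * max CB 0) := by
          refine mul_le_mul_of_nonneg_left ?_ hC0
          refine mul_le_mul_of_nonneg_left ?_ (by positivity)
          exact le_trans hS (le_max_left _ _)
      _ = max C 0 * (2 * ℓ + 1) * max CB 0 := by ring
  calc a = (a / ((N : ℝ) - 1)) * ((N : ℝ) - 1) := by field_simp
    _ ≤ (a / ((N : ℝ) - 1)) * (2 * ((N : ℝ) - 2 * b - 1)) := by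
        refine mul_le_mul_of_nonneg_left ?_ hq
        linarith
    _ = 2 * (((N : ℝ) - 2 * b - 1) * (a / ((N : ℝ) - 1))) := by ring
    _ ≤ 2 * (max C 0 * (2 * ℓ + 1) * max CB 0) := by linarith

/-- **The glue item `LocalOhmGlue` of route LocalOhmBV** (stmt-AtomisticToContinuum-12072):
`FiniteResponseProfile → LocalOhm → BVProfile → BoundedResponse`. Along any steady-state family
(under uniqueness) and `T > 0`, choosing the response profiles from `FiniteResponseProfile`,
summing the local Ohm inequality over the bulk bonds and bounding the double-counted windowed
variation by `(2ℓ+1)` times the BV bound gives `|D_N| ≤ 2 max(C,0)(2ℓ+1) max(C_BV,0)` for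
`N ≥ 4b+2`; the finitely many smaller `N` are dominated by `Σ_{M<4b+2} |D_M|`. [folklore] -/
theorem localOhmGlue_proof :
    Summit.AtomisticToContinuum.FouriersLaw.Theses.LocalOhmBV.LocalOhmGlue := by
  unfold Summit.AtomisticToContinuum.FouriersLaw.Theses.LocalOhmBV.LocalOhmGlue
  intro hFP hLO hBV ω₂ lam β γ hω hl hβ hγ hUq μ hμ T hT D hD
  have hprof := hFP ω₂ lam β γ hω hl hβ hγ hUq μ hμ T hT
  choose θ hθ using hprof
  obtain ⟨C, ℓ, b, hC⟩ := hLO ω₂ lam β γ hω hl hβ hγ hUq μ hμ T hT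
  obtain ⟨CB, hCB⟩ := hBV ω₂ lam β γ hω hl hβ hγ hUq μ hμ T hT
  have hbig : ∀ N : ℕ, 4 * b + 2 ≤ N → |D N| ≤ 2 * (max C 0 * (2 * ℓ + 1) * max CB 0) :=
    fun N hN => localOhmGlue_bulk_bound (θ N) (abs_nonneg (D N)) hN
      (fun x hx1 hx2 => hC N (D N) (θ N) (hD N) (hθ N) x hx1 hx2) (hCB N (θ N) (hθ N))
  refine ⟨max (2 * (max C 0 * (2 * ℓ + 1) * max CB 0))
    (∑ M ∈ Finset.range (4 * b + 2), |D M|), ?_⟩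
  rintro y ⟨N, rfl⟩
  dsimp only
  by_cases hN : 4 * b + 2 ≤ N
  · exact le_trans (hbig N hN) (le_max_left _ _)
  · refine le_trans ?_ (le_max_right _ _)
    have hmem : N ∈ Finset.range (4 * b + 2) := Finset.mem_range.mpr (Nat.lt_of_not_le hN)
    exact Finset.single_le_sum (f := fun M => |D M|) (fun M _ => abs_nonneg (D M)) hmem

end Summit.AtomisticToContinuum.FouriersLaw.Theorems
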